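import Summits.Parity.GeneralizedHardyLittlewood.Theorems.PrimeLevelFamEdgeMomentsBeyondDiagonalFarLayersKernel
import Summits.Parity.GeneralizedHardyLittlewood.Theorems.PrimeLevelFamEdgeMomentsBeyondDiagonalTwoOrderBoxError
import HarnessLib

/-!
# Route `PrimeLevelFamEdge`, crux K_A `MomentsBeyondDiagonal` (stmt-Parity-20007), line «petersson_layers» v4:
# the FAR PETERSSON LAYERS — the weight step, the mollifier pair sum and the level split (inputs of the per-order box bound)

For `q` prime `≥ 64`, `0 < Δ' ≤ 3/2` (`M = q̂^{Δ'}`) and a layer threshold `R` with `R + 1 ≥ q̂^{4Δ' − 3/2}` (the WEIL CUT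
`ρ_W` of deck 21b §5b), the order-`(i,j)` box sum of the far layers
`Σ_{n₁,n₂ ≤ q²} (n₁n₂)^{−1/2} W_{ij}(q̂;n₁,n₂) Σ_{m₁,m₂ ≤ M} x_{m₁}x_{m₂} Σ_{d₁,d₂} Σ_{R < r ≤ q⁸} (2π/q) r⁻¹ S(a,b;qr) J₁(4π√(ab)/(qr))`
is `≤ A_{P,i,j} · ((1+log q̂)(1+2 log q))^{i+j} · q̂^{−3/40}` (`norm_farBox₂_le`, file `…FarLayersBox`). This file holds its
three inputs: §1 the weight step `weight₂_mul_sqrt_le` (`norm_afeW_le_logsep` at `A = 51/50`: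
`‖(n₁n₂)^{−1/2}W_{ij}‖√(n₁n₂) ≤ K L q̂^{51/25} n₁^{−51/50}n₂^{−51/50}`); §2 the mollifier pair sum against the summed far-layer
kernel `norm_pairSum_far_le` (the gcd-honest kernel sum `FarLayers.sum_norm_layerKernel_le` — Weil + `|J₁(x)| ≤ x/2` + gcd
sum —, `|x_m| ≤ B m^{−1/2}`, `τ ≤ C(·)^{1/100}`: `≤ c · B²C³M^{203/100} · √(n₁,q) τ(n₁) √(n₁n₂)`); §3 the level split
`Σ_{n ≤ q²} n^{−51/50} τ(n) √(n,q) ≤ 2Cζ` (`sum_box_rpow_divisors_gcd_le`: the multiples of `q` carry `√q · q^{−101/100} ≤ 1`).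
Proof only (helper toward `stub_farP : SubFar rhoP`); K_A NOT proved; nothing about Landau–Siegel zeros.
-/

noncomputable section

open scoped Real Nat
open Complex Finset Polynomial MeasureTheory
open Literature.NumberTheory.LFunctions

namespace Summit.Parity.GeneralizedHardyLittlewood.Theorems.MomentsBeyondDiagonal.FarLayers

open Summit.Parity.GeneralizedHardyLittlewood.Theorems.PrimeLevelFamEdgeIdeaDeltas.PeterssonLayers
open Summit.Parity.GeneralizedHardyLittlewood.Theorems.MomentsBeyondDiagonal.TwoOrderAFE (norm_afeW_le_logsep)

/-! ## §1. The two-order weight against `√(n₁n₂)` -/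

/-- **The two-order weight in the box, against `√(n₁n₂)`**: there is `K ≥ 0` (depending on `i, j` only) such that for
`q ≥ 64` and `n₁, n₂` in the AFE box, `‖(n₁n₂)^{−1/2} W_{ij}(q̂;n₁,n₂)‖ √(n₁n₂) ≤ K ((1+log q̂)(1+2 log q))^{i+j} q̂^{51/25}
n₁^{−51/50} n₂^{−51/50}` (`norm_afeW_le_logsep` at `A = 51/50`). [cite: KowalskiMichelVanderKam2000, (22) p. 12 and (15) p. 9] -/
theorem weight₂_mul_sqrt_le (i j : ℕ) :
    ∃ K : ℝ, 0 ≤ K ∧ ∀ {q : ℕ} [NeZero q], 64 ≤ q → ∀ {n₁ n₂ : ℕ}, n₁ ∈ afeBox q → n₂ ∈ afeBox q →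
      ‖((((n₁ : ℝ) * n₂) ^ (-(1 / 2 : ℝ)) : ℝ) : ℂ) * KMV2000.afeW (KMV2000.qhat q) i j n₁ n₂‖ *
          Real.sqrt ((n₁ : ℝ) * n₂) ≤
        K * ((1 + Real.log (KMV2000.qhat q)) * (1 + 2 * Real.log q)) ^ (i + j) * KMV2000.qhat q ^ (51 / 25 : ℝ) *
          (((n₁ : ℝ)) ^ (-(51 / 50 : ℝ)) * ((n₂ : ℝ)) ^ (-(51 / 50 : ℝ))) := by
  set K : ℝ := (∫ x in Set.Ioi (0 : ℝ), x ^ (51 / 50 : ℝ) * (Real.exp (-x) * (2 ^ i * (1 + |Real.log x| ^ i)))) *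
    ∫ x in Set.Ioi (0 : ℝ), x ^ (51 / 50 : ℝ) * (Real.exp (-x) * (2 ^ j * (1 + |Real.log x| ^ j))) with hK
  have hK0 : 0 ≤ K :=
    mul_nonneg (setIntegral_nonneg measurableSet_Ioi fun x hx ↦ by have hx : (0 : ℝ) < x := hx; positivity)
      (setIntegral_nonneg measurableSet_Ioi fun x hx ↦ by have hx : (0 : ℝ) < x := hx; positivity)
  refine ⟨K, hK0, fun {q} _ h64 {n₁ n₂} hn₁ hn₂ ↦ ?_⟩
  have hqh1 : 1 < KMV2000.qhat q := one_lt_qhat h64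
  have hqh0 : 0 < KMV2000.qhat q := zero_lt_one.trans hqh1
  have h₁ : n₁ ≠ 0 := ne_zero_of_mem_afeBox hn₁
  have h₂ : n₂ ≠ 0 := ne_zero_of_mem_afeBox hn₂
  have hn₁0 : (0 : ℝ) < n₁ := by exact_mod_cast Nat.pos_of_ne_zero h₁
  have hn₂0 : (0 : ℝ) < n₂ := by exact_mod_cast Nat.pos_of_ne_zero h₂
  have hN : (0 : ℝ) < (n₁ : ℝ) * n₂ := mul_pos hn₁0 hn₂0
  have hlogbox : ∀ {n : ℕ}, n ∈ afeBox q → 1 + Real.log (n : ℝ) ≤ 1 + 2 * Real.log q := by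
    intro n hn
    have hn' := Finset.mem_Icc.mp hn
    have hn0 : (0 : ℝ) < n := by exact_mod_cast hn'.1
    have hle : (n : ℝ) ≤ ((q : ℝ)) ^ 2 := by exact_mod_cast hn'.2
    have := Real.log_le_log hn0 hle
    rw [Real.log_pow] at this
    push_cast at this
    linarith
  have hW := norm_afeW_le_logsep hqh1.le i j (by norm_num : (0 : ℝ) ≤ 51 / 50) h₁ h₂
  have hLq : 0 ≤ 1 + Real.log (KMV2000.qhat q) := by linarith [Real.log_nonneg hqh1.le]
  have hl₁ : 0 ≤ 1 + Real.log (n₁ : ℝ) := by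
    linarith [Real.log_nonneg (show (1 : ℝ) ≤ n₁ by exact_mod_cast Nat.one_le_iff_ne_zero.mpr h₁)]
  have hl₂ : 0 ≤ 1 + Real.log (n₂ : ℝ) := by
    linarith [Real.log_nonneg (show (1 : ℝ) ≤ n₂ by exact_mod_cast Nat.one_le_iff_ne_zero.mpr h₂)]
  have hlogs : (1 + Real.log (KMV2000.qhat q)) ^ (i + j) * (1 + Real.log n₁) ^ i * (1 + Real.log n₂) ^ j ≤
      ((1 + Real.log (KMV2000.qhat q)) * (1 + 2 * Real.log q)) ^ (i + j) := by
    rw [mul_pow, pow_add (1 + 2 * Real.log (q : ℝ))]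
    have g₁ : (1 + Real.log (n₁ : ℝ)) ^ i ≤ (1 + 2 * Real.log q) ^ i := pow_le_pow_left₀ hl₁ (hlogbox hn₁) i
    have g₂ : (1 + Real.log (n₂ : ℝ)) ^ j ≤ (1 + 2 * Real.log q) ^ j := pow_le_pow_left₀ hl₂ (hlogbox hn₂) j
    calc (1 + Real.log (KMV2000.qhat q)) ^ (i + j) * (1 + Real.log n₁) ^ i * (1 + Real.log n₂) ^ j
        = (1 + Real.log (KMV2000.qhat q)) ^ (i + j) * ((1 + Real.log n₁) ^ i * (1 + Real.log n₂) ^ j) := by ring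
      _ ≤ (1 + Real.log (KMV2000.qhat q)) ^ (i + j) * ((1 + 2 * Real.log q) ^ i * (1 + 2 * Real.log q) ^ j) :=
          mul_le_mul_of_nonneg_left (mul_le_mul g₁ g₂ (pow_nonneg hl₂ j) ((pow_nonneg hl₁ i).trans g₁))
            (pow_nonneg hLq _)
  -- exponent algebra: `(n₁n₂)^{-1/2} (q̂²/n₁n₂)^{51/50} √(n₁n₂) = q̂^{51/25} n₁^{-51/50} n₂^{-51/50}`
  have e1 : (KMV2000.qhat q ^ 2 / ((n₁ : ℝ) * n₂)) ^ (51 / 50 : ℝ) =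
      ((n₁ : ℝ) * n₂) ^ (-(51 / 50 : ℝ)) * KMV2000.qhat q ^ (51 / 25 : ℝ) := by
    rw [Real.div_rpow (pow_nonneg hqh0.le 2) hN.le, Real.rpow_neg hN.le, div_eq_mul_inv,
      ← Real.rpow_natCast (KMV2000.qhat q) 2, ← Real.rpow_mul hqh0.le]
    norm_num
    ring
  have e2 : ((n₁ : ℝ) * n₂) ^ (-(1 / 2 : ℝ)) * (((n₁ : ℝ) * n₂) ^ (-(51 / 50 : ℝ))) * Real.sqrt ((n₁ : ℝ) * n₂) =
      ((n₁ : ℝ)) ^ (-(51 / 50 : ℝ)) * ((n₂ : ℝ)) ^ (-(51 / 50 : ℝ)) := by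
    rw [Real.sqrt_eq_rpow, show ((n₁ : ℝ) * n₂) ^ (-(1 / 2 : ℝ)) * (((n₁ : ℝ) * n₂) ^ (-(51 / 50 : ℝ))) *
        ((n₁ : ℝ) * n₂) ^ (1 / 2 : ℝ) = (((n₁ : ℝ) * n₂) ^ (-(1 / 2 : ℝ)) * ((n₁ : ℝ) * n₂) ^ (1 / 2 : ℝ)) *
        ((n₁ : ℝ) * n₂) ^ (-(51 / 50 : ℝ)) by ring, ← Real.rpow_add hN, ← Real.mul_rpow hn₁0.le hn₂0.le]
    norm_num
  have hnorm : ‖((((n₁ : ℝ) * n₂) ^ (-(1 / 2 : ℝ)) : ℝ) : ℂ) * KMV2000.afeW (KMV2000.qhat q) i j n₁ n₂‖ =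
      ((n₁ : ℝ) * n₂) ^ (-(1 / 2 : ℝ)) * ‖KMV2000.afeW (KMV2000.qhat q) i j n₁ n₂‖ := by
    rw [norm_mul, Complex.norm_real, Real.norm_eq_abs, abs_of_nonneg (Real.rpow_nonneg hN.le _)]
  rw [hnorm]
  have hr0 : 0 ≤ ((n₁ : ℝ) * n₂) ^ (-(1 / 2 : ℝ)) := Real.rpow_nonneg hN.le _
  have hs0 : 0 ≤ Real.sqrt ((n₁ : ℝ) * n₂) := Real.sqrt_nonneg _
  have hy : 0 ≤ (KMV2000.qhat q ^ 2 / ((n₁ : ℝ) * n₂)) ^ (51 / 50 : ℝ) := Real.rpow_nonneg (by positivity) _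
  calc ((n₁ : ℝ) * n₂) ^ (-(1 / 2 : ℝ)) * ‖KMV2000.afeW (KMV2000.qhat q) i j n₁ n₂‖ * Real.sqrt ((n₁ : ℝ) * n₂)
      ≤ ((n₁ : ℝ) * n₂) ^ (-(1 / 2 : ℝ)) * (K * (KMV2000.qhat q ^ 2 / ((n₁ : ℝ) * n₂)) ^ (51 / 50 : ℝ) *
          ((1 + Real.log (KMV2000.qhat q)) * (1 + 2 * Real.log q)) ^ (i + j)) * Real.sqrt ((n₁ : ℝ) * n₂) := by
        refine mul_le_mul_of_nonneg_right (mul_le_mul_of_nonneg_left (hW.trans ?_) hr0) hs0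
        exact mul_le_mul_of_nonneg_left hlogs (mul_nonneg hK0 hy)
    _ = K * ((1 + Real.log (KMV2000.qhat q)) * (1 + 2 * Real.log q)) ^ (i + j) *
          (((n₁ : ℝ) * n₂) ^ (-(1 / 2 : ℝ)) * (KMV2000.qhat q ^ 2 / ((n₁ : ℝ) * n₂)) ^ (51 / 50 : ℝ) *
            Real.sqrt ((n₁ : ℝ) * n₂)) := by ring
    _ = K * ((1 + Real.log (KMV2000.qhat q)) * (1 + 2 * Real.log q)) ^ (i + j) *
          (KMV2000.qhat q ^ (51 / 25 : ℝ) *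
            (((n₁ : ℝ) * n₂) ^ (-(1 / 2 : ℝ)) * (((n₁ : ℝ) * n₂) ^ (-(51 / 50 : ℝ))) * Real.sqrt ((n₁ : ℝ) * n₂))) := by
        rw [e1]; ring
    _ = _ := by rw [e2]; ring

/-! ## §2. The mollifier pair sum against the far-layer kernel -/

/-- **The mollifier pair sum against the far layers' kernel, at a box point `(n₁, n₂)`.** For `q` prime, `|P| ≤ B` on
`[0,1]`, `1 < M`, `⌊M⌋ < q`, `τ ≤ C(·)^{1/100}`, `n₁, n₂ ≠ 0` and any `R ≤ R₂`:
`‖Σ_{m₁,m₂ ≤ M} x_{m₁}x_{m₂} Σ_{d₁,d₂} Σ_{R < r ≤ R₂} K_r-kernel(a,b)‖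
  ≤ (8π²Cζ q^{−3/2} (R+1)^{−12/25}) · (B²C³ M^{203/100}) · √((n₁,q)) τ(n₁) √(n₁n₂)`
(`|x_m| ≤ B m^{−1/2}`, `τ((m,n)) ≤ τ(m) ≤ C m^{1/100}`, `FarLayers.sum_norm_layerKernel_le`, `Σ_{m ≤ M} m^e ≤ M^{e+1}`).
[cite: KowalskiMichelVanderKam2000, Lemma 3.1 (10) p. 8; KowalskiMichel2000, §2.4.2 p. 312] -/
theorem norm_pairSum_far_le {q : ℕ} [NeZero q] (hq : q.Prime) {P : ℝ[X]} {B C M : ℝ}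
    (hB : ∀ t ∈ Set.Icc (0 : ℝ) 1, |P.eval t| ≤ B) (hM : 1 < M) (hMq : ⌊M⌋₊ < q)
    (hC : ∀ r : ℕ, ((r.divisors.card : ℕ) : ℝ) ≤ C * (r : ℝ) ^ (1 / 100 : ℝ))
    {n₁ n₂ : ℕ} (hn₁ : n₁ ≠ 0) (hn₂ : n₂ ≠ 0) (R R₂ : ℕ) :
    ‖∑ m₁ ∈ Icc 1 ⌊M⌋₊, ∑ m₂ ∈ Icc 1 ⌊M⌋₊,
        (KMV2000.mollifierCoeff P M m₁ : ℂ) * (KMV2000.mollifierCoeff P M m₂ : ℂ) *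
        ∑ d₁ ∈ (Nat.gcd m₁ n₁).divisors, ∑ d₂ ∈ (Nat.gcd m₂ n₂).divisors,
          ∑ r ∈ Icc (R + 1) R₂, layerKernel q r (m₁ * n₁ / d₁ ^ 2) (m₂ * n₂ / d₂ ^ 2)‖ ≤
      (8 * π ^ 2 * C * (∑' k : ℕ, ((k : ℝ)) ^ (-(101 / 100 : ℝ))) *
          ((q : ℝ)) ^ (-(3 / 2 : ℝ)) * (((R + 1 : ℕ) : ℝ)) ^ (-(12 / 25 : ℝ))) *
        (B ^ 2 * C ^ 3 * M ^ (203 / 100 : ℝ)) *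
        (Real.sqrt ((Nat.gcd n₁ q : ℕ) : ℝ) * ((n₁.divisors.card : ℕ) : ℝ) * Real.sqrt ((n₁ : ℝ) * n₂)) := by
  set Z : ℝ := ∑' k : ℕ, ((k : ℝ)) ^ (-(101 / 100 : ℝ)) with hZ
  have hZ0 : 0 ≤ Z := tsum_nonneg fun k ↦ Real.rpow_nonneg (Nat.cast_nonneg _) _
  have hB0 : 0 ≤ B := le_trans (abs_nonneg _) (hB 0 (by simp))
  have hC0 : 0 ≤ C := by have h := hC 1; simp at h; linarith
  have hM0 : 0 < M := by linarith
  have hn₁0 : (0 : ℝ) < n₁ := by exact_mod_cast Nat.pos_of_ne_zero hn₁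
  have hn₂0 : (0 : ℝ) < n₂ := by exact_mod_cast Nat.pos_of_ne_zero hn₂
  set c : ℝ := 8 * π ^ 2 * C * Z * ((q : ℝ)) ^ (-(3 / 2 : ℝ)) * (((R + 1 : ℕ) : ℝ)) ^ (-(12 / 25 : ℝ)) with hc
  have hc0 : 0 ≤ c := by positivity
  set G : ℝ := Real.sqrt ((Nat.gcd n₁ q : ℕ) : ℝ) * ((n₁.divisors.card : ℕ) : ℝ) * Real.sqrt ((n₁ : ℝ) * n₂) with hG
  have hG0 : 0 ≤ G := by positivity
  -- termwise bound
  have hpt : ∀ m₁ ∈ Icc 1 ⌊M⌋₊, ∀ m₂ ∈ Icc 1 ⌊M⌋₊,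
      ‖(KMV2000.mollifierCoeff P M m₁ : ℂ) * (KMV2000.mollifierCoeff P M m₂ : ℂ) *
        ∑ d₁ ∈ (Nat.gcd m₁ n₁).divisors, ∑ d₂ ∈ (Nat.gcd m₂ n₂).divisors,
          ∑ r ∈ Icc (R + 1) R₂, layerKernel q r (m₁ * n₁ / d₁ ^ 2) (m₂ * n₂ / d₂ ^ 2)‖ ≤
        c * (B ^ 2 * C ^ 3) * G * (((m₁ : ℝ)) ^ (1 / 50 : ℝ) * ((m₂ : ℝ)) ^ (1 / 100 : ℝ)) := by
    intro m₁ hm₁ m₂ hm₂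
    have hm₁' := Finset.mem_Icc.mp hm₁
    have hm₂' := Finset.mem_Icc.mp hm₂
    have hm₁0 : (0 : ℝ) < m₁ := by exact_mod_cast hm₁'.1
    have hm₂0 : (0 : ℝ) < m₂ := by exact_mod_cast hm₂'.1
    have hm₁q : m₁ < q := lt_of_le_of_lt hm₁'.2 hMq
    have hx₁ := norm_mollifierCoeff_le hB hM hm₁
    have hx₂ := norm_mollifierCoeff_le hB hM hm₂
    have hτ₁ : (((Nat.gcd m₁ n₁).divisors.card : ℕ) : ℝ) ≤ C * (m₁ : ℝ) ^ (1 / 100 : ℝ) :=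
      le_trans (by exact_mod_cast card_divisors_gcd_le hm₁'.1 n₁) (hC m₁)
    have hτ₂ : (((Nat.gcd m₂ n₂).divisors.card : ℕ) : ℝ) ≤ C * (m₂ : ℝ) ^ (1 / 100 : ℝ) :=
      le_trans (by exact_mod_cast card_divisors_gcd_le hm₂'.1 n₂) (hC m₂)
    have hτm₁ : ((m₁.divisors.card : ℕ) : ℝ) ≤ C * (m₁ : ℝ) ^ (1 / 100 : ℝ) := hC m₁
    -- the kernel sum at each `(d₁, d₂)`
    have hker : ∀ d₁ ∈ (Nat.gcd m₁ n₁).divisors, ∀ d₂ ∈ (Nat.gcd m₂ n₂).divisors,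
        ‖∑ r ∈ Icc (R + 1) R₂, layerKernel q r (m₁ * n₁ / d₁ ^ 2) (m₂ * n₂ / d₂ ^ 2)‖ ≤
          c * (Real.sqrt ((Nat.gcd n₁ q : ℕ) : ℝ) * ((m₁.divisors.card : ℕ) : ℝ) * ((n₁.divisors.card : ℕ) : ℝ) *
            Real.sqrt (((m₁ : ℝ) * n₁) * ((m₂ : ℝ) * n₂))) := by
      intro d₁ hd₁ d₂ _
      refine (norm_sum_le _ _).trans ?_
      have h := sum_norm_layerKernel_le hq hC m₂ n₂ d₂ hm₁'.1 hm₁q hn₁ hd₁ R R₂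
      rw [hc]
      exact h
    have hdd : ‖∑ d₁ ∈ (Nat.gcd m₁ n₁).divisors, ∑ d₂ ∈ (Nat.gcd m₂ n₂).divisors,
        ∑ r ∈ Icc (R + 1) R₂, layerKernel q r (m₁ * n₁ / d₁ ^ 2) (m₂ * n₂ / d₂ ^ 2)‖ ≤
        (C * (m₁ : ℝ) ^ (1 / 100 : ℝ)) * (C * (m₂ : ℝ) ^ (1 / 100 : ℝ)) *
          (c * (Real.sqrt ((Nat.gcd n₁ q : ℕ) : ℝ) * (C * (m₁ : ℝ) ^ (1 / 100 : ℝ)) * ((n₁.divisors.card : ℕ) : ℝ) *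
            Real.sqrt (((m₁ : ℝ) * n₁) * ((m₂ : ℝ) * n₂)))) := by
      calc ‖∑ d₁ ∈ (Nat.gcd m₁ n₁).divisors, ∑ d₂ ∈ (Nat.gcd m₂ n₂).divisors,
            ∑ r ∈ Icc (R + 1) R₂, layerKernel q r (m₁ * n₁ / d₁ ^ 2) (m₂ * n₂ / d₂ ^ 2)‖
          ≤ ∑ d₁ ∈ (Nat.gcd m₁ n₁).divisors, ∑ d₂ ∈ (Nat.gcd m₂ n₂).divisors,
              ‖∑ r ∈ Icc (R + 1) R₂, layerKernel q r (m₁ * n₁ / d₁ ^ 2) (m₂ * n₂ / d₂ ^ 2)‖ :=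
            (norm_sum_le _ _).trans (Finset.sum_le_sum fun _ _ ↦ norm_sum_le _ _)
        _ ≤ ∑ d₁ ∈ (Nat.gcd m₁ n₁).divisors, ∑ d₂ ∈ (Nat.gcd m₂ n₂).divisors,
              c * (Real.sqrt ((Nat.gcd n₁ q : ℕ) : ℝ) * ((m₁.divisors.card : ℕ) : ℝ) * ((n₁.divisors.card : ℕ) : ℝ) *
                Real.sqrt (((m₁ : ℝ) * n₁) * ((m₂ : ℝ) * n₂))) :=
            Finset.sum_le_sum fun d₁ hd₁ ↦ Finset.sum_le_sum fun d₂ hd₂ ↦ hker d₁ hd₁ d₂ hd₂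
        _ = (((Nat.gcd m₁ n₁).divisors.card : ℕ) : ℝ) * (((Nat.gcd m₂ n₂).divisors.card : ℕ) : ℝ) *
              (c * (Real.sqrt ((Nat.gcd n₁ q : ℕ) : ℝ) * ((m₁.divisors.card : ℕ) : ℝ) * ((n₁.divisors.card : ℕ) : ℝ) *
                Real.sqrt (((m₁ : ℝ) * n₁) * ((m₂ : ℝ) * n₂)))) := by
            rw [Finset.sum_const, Finset.sum_const, nsmul_eq_mul, nsmul_eq_mul]; ring
        _ ≤ _ := by gcongr
    -- exponent algebra
    have e₃ : Real.sqrt (((m₁ : ℝ) * n₁) * ((m₂ : ℝ) * n₂)) =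
        (m₁ : ℝ) ^ (1 / 2 : ℝ) * (m₂ : ℝ) ^ (1 / 2 : ℝ) * Real.sqrt ((n₁ : ℝ) * n₂) := by
      rw [show ((m₁ : ℝ) * n₁) * ((m₂ : ℝ) * n₂) = ((m₁ : ℝ) * m₂) * ((n₁ : ℝ) * n₂) by ring,
        Real.sqrt_mul (by positivity), Real.sqrt_mul hm₁0.le, Real.sqrt_eq_rpow, Real.sqrt_eq_rpow]
    have e₁ : (m₁ : ℝ) ^ (-(1 / 2 : ℝ)) * (m₁ : ℝ) ^ (1 / 100 : ℝ) * (m₁ : ℝ) ^ (1 / 100 : ℝ) * (m₁ : ℝ) ^ (1 / 2 : ℝ) =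
        (m₁ : ℝ) ^ (1 / 50 : ℝ) := by
      rw [← Real.rpow_add hm₁0, ← Real.rpow_add hm₁0, ← Real.rpow_add hm₁0]; norm_num
    have e₂ : (m₂ : ℝ) ^ (-(1 / 2 : ℝ)) * (m₂ : ℝ) ^ (1 / 100 : ℝ) * (m₂ : ℝ) ^ (1 / 2 : ℝ) =
        (m₂ : ℝ) ^ (1 / 100 : ℝ) := by
      rw [← Real.rpow_add hm₂0, ← Real.rpow_add hm₂0]; norm_num
    rw [norm_mul, norm_mul]
    calc ‖(KMV2000.mollifierCoeff P M m₁ : ℂ)‖ * ‖(KMV2000.mollifierCoeff P M m₂ : ℂ)‖ *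
          ‖∑ d₁ ∈ (Nat.gcd m₁ n₁).divisors, ∑ d₂ ∈ (Nat.gcd m₂ n₂).divisors,
            ∑ r ∈ Icc (R + 1) R₂, layerKernel q r (m₁ * n₁ / d₁ ^ 2) (m₂ * n₂ / d₂ ^ 2)‖
        ≤ (B * (m₁ : ℝ) ^ (-(1 / 2 : ℝ))) * (B * (m₂ : ℝ) ^ (-(1 / 2 : ℝ))) *
            ((C * (m₁ : ℝ) ^ (1 / 100 : ℝ)) * (C * (m₂ : ℝ) ^ (1 / 100 : ℝ)) *
              (c * (Real.sqrt ((Nat.gcd n₁ q : ℕ) : ℝ) * (C * (m₁ : ℝ) ^ (1 / 100 : ℝ)) *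
                ((n₁.divisors.card : ℕ) : ℝ) * Real.sqrt (((m₁ : ℝ) * n₁) * ((m₂ : ℝ) * n₂))))) := by
          gcongr
      _ = c * (B ^ 2 * C ^ 3) * G *
            (((m₁ : ℝ) ^ (-(1 / 2 : ℝ)) * (m₁ : ℝ) ^ (1 / 100 : ℝ) * (m₁ : ℝ) ^ (1 / 100 : ℝ) * (m₁ : ℝ) ^ (1 / 2 : ℝ)) *
              ((m₂ : ℝ) ^ (-(1 / 2 : ℝ)) * (m₂ : ℝ) ^ (1 / 100 : ℝ) * (m₂ : ℝ) ^ (1 / 2 : ℝ))) := by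
          rw [e₃, hG]; ring
      _ = _ := by rw [e₁, e₂]
  -- the two mollifier sums
  have hS₁ : ∑ m ∈ Icc 1 ⌊M⌋₊, ((m : ℝ)) ^ (1 / 50 : ℝ) ≤ M ^ (51 / 50 : ℝ) := by
    have h := sum_Icc_rpow_le (M := M) (e := 1 / 50) hM.le (by norm_num)
    rw [show (1 / 50 + 1 : ℝ) = 51 / 50 by norm_num] at h
    exact h
  have hS₂ : ∑ m ∈ Icc 1 ⌊M⌋₊, ((m : ℝ)) ^ (1 / 100 : ℝ) ≤ M ^ (101 / 100 : ℝ) := by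
    have h := sum_Icc_rpow_le (M := M) (e := 1 / 100) hM.le (by norm_num)
    rw [show (1 / 100 + 1 : ℝ) = 101 / 100 by norm_num] at h
    exact h
  have hS₁0 : 0 ≤ ∑ m ∈ Icc 1 ⌊M⌋₊, ((m : ℝ)) ^ (1 / 50 : ℝ) :=
    Finset.sum_nonneg fun m _ ↦ Real.rpow_nonneg (Nat.cast_nonneg _) _
  have hS₂0 : 0 ≤ ∑ m ∈ Icc 1 ⌊M⌋₊, ((m : ℝ)) ^ (1 / 100 : ℝ) :=
    Finset.sum_nonneg fun m _ ↦ Real.rpow_nonneg (Nat.cast_nonneg _) _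
  have hSS : (∑ m ∈ Icc 1 ⌊M⌋₊, ((m : ℝ)) ^ (1 / 50 : ℝ)) * (∑ m ∈ Icc 1 ⌊M⌋₊, ((m : ℝ)) ^ (1 / 100 : ℝ)) ≤
      M ^ (203 / 100 : ℝ) := by
    calc _ ≤ M ^ (51 / 50 : ℝ) * M ^ (101 / 100 : ℝ) := mul_le_mul hS₁ hS₂ hS₂0 (Real.rpow_nonneg hM0.le _)
      _ = M ^ (203 / 100 : ℝ) := by rw [← Real.rpow_add hM0]; norm_num
  calc ‖∑ m₁ ∈ Icc 1 ⌊M⌋₊, ∑ m₂ ∈ Icc 1 ⌊M⌋₊,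
        (KMV2000.mollifierCoeff P M m₁ : ℂ) * (KMV2000.mollifierCoeff P M m₂ : ℂ) *
        ∑ d₁ ∈ (Nat.gcd m₁ n₁).divisors, ∑ d₂ ∈ (Nat.gcd m₂ n₂).divisors,
          ∑ r ∈ Icc (R + 1) R₂, layerKernel q r (m₁ * n₁ / d₁ ^ 2) (m₂ * n₂ / d₂ ^ 2)‖
      ≤ ∑ m₁ ∈ Icc 1 ⌊M⌋₊, ∑ m₂ ∈ Icc 1 ⌊M⌋₊,
          ‖(KMV2000.mollifierCoeff P M m₁ : ℂ) * (KMV2000.mollifierCoeff P M m₂ : ℂ) *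
            ∑ d₁ ∈ (Nat.gcd m₁ n₁).divisors, ∑ d₂ ∈ (Nat.gcd m₂ n₂).divisors,
              ∑ r ∈ Icc (R + 1) R₂, layerKernel q r (m₁ * n₁ / d₁ ^ 2) (m₂ * n₂ / d₂ ^ 2)‖ :=
        (norm_sum_le _ _).trans (Finset.sum_le_sum fun _ _ ↦ norm_sum_le _ _)
    _ ≤ ∑ m₁ ∈ Icc 1 ⌊M⌋₊, ∑ m₂ ∈ Icc 1 ⌊M⌋₊,
          c * (B ^ 2 * C ^ 3) * G * (((m₁ : ℝ)) ^ (1 / 50 : ℝ) * ((m₂ : ℝ)) ^ (1 / 100 : ℝ)) :=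
        Finset.sum_le_sum fun m₁ hm₁ ↦ Finset.sum_le_sum fun m₂ hm₂ ↦ hpt m₁ hm₁ m₂ hm₂
    _ = c * (B ^ 2 * C ^ 3) * G *
          ((∑ m ∈ Icc 1 ⌊M⌋₊, ((m : ℝ)) ^ (1 / 50 : ℝ)) * (∑ m ∈ Icc 1 ⌊M⌋₊, ((m : ℝ)) ^ (1 / 100 : ℝ))) := by
        rw [Finset.sum_mul_sum, Finset.mul_sum]
        refine Finset.sum_congr rfl fun m₁ _ ↦ ?_
        rw [Finset.mul_sum]
    _ ≤ c * (B ^ 2 * C ^ 3) * G * M ^ (203 / 100 : ℝ) :=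
        mul_le_mul_of_nonneg_left hSS (by positivity)
    _ = _ := by rw [hc, hG]; ring

/-! ## §3. The level split in the `n₁`-sum -/

/-- For `q` prime: `√((n, q)) ≤ 1 + [q ∣ n] √q`. -/
theorem sqrt_gcd_prime_le {q : ℕ} (hq : q.Prime) (n : ℕ) :
    Real.sqrt ((Nat.gcd n q : ℕ) : ℝ) ≤ 1 + (if q ∣ n then Real.sqrt (q : ℝ) else 0) := by
  split_ifs with h
  · have hg : Nat.gcd n q = q := Nat.gcd_eq_right h
    rw [hg]
    linarith [Real.sqrt_nonneg (q : ℝ)]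
  · have hg : Nat.gcd n q = 1 := (Nat.coprime_comm.mp ((Nat.Prime.coprime_iff_not_dvd hq).mpr h))
    rw [hg]
    simp

/-- **The level split**: for `q` prime and `τ ≤ C(·)^{1/100}`,
`Σ_{n ≤ q²} n^{−51/50} τ(n) √((n,q)) ≤ 2C ζ_ℕ(101/100)` — the `n` prime to `q` give `C Σ n^{−101/100}`, the multiples
`n = qk` give `√q · q^{−101/100} · C Σ k^{−101/100} ≤ Cζ`. -/
theorem sum_box_rpow_divisors_gcd_le {q : ℕ} [NeZero q] (hq : q.Prime) {C : ℝ}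
    (hC : ∀ r : ℕ, ((r.divisors.card : ℕ) : ℝ) ≤ C * (r : ℝ) ^ (1 / 100 : ℝ)) :
    ∑ n ∈ afeBox q, ((n : ℝ)) ^ (-(51 / 50 : ℝ)) * (((n.divisors.card : ℕ) : ℝ) * Real.sqrt ((Nat.gcd n q : ℕ) : ℝ)) ≤
      2 * C * ∑' k : ℕ, ((k : ℝ)) ^ (-(101 / 100 : ℝ)) := by
  set Z : ℝ := ∑' k : ℕ, ((k : ℝ)) ^ (-(101 / 100 : ℝ)) with hZ
  have hZ0 : 0 ≤ Z := tsum_nonneg fun k ↦ Real.rpow_nonneg (Nat.cast_nonneg _) _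
  have hC0 : 0 ≤ C := by have h := hC 1; simp at h; linarith
  have hq0 : (0 : ℝ) < q := by exact_mod_cast hq.pos
  have hq1 : (1 : ℝ) ≤ q := by exact_mod_cast hq.one_lt.le
  -- termwise
  have hpt : ∀ n ∈ afeBox q,
      ((n : ℝ)) ^ (-(51 / 50 : ℝ)) * (((n.divisors.card : ℕ) : ℝ) * Real.sqrt ((Nat.gcd n q : ℕ) : ℝ)) ≤
        C * (((n : ℝ)) ^ (-(101 / 100 : ℝ)) * (1 + (if q ∣ n then Real.sqrt (q : ℝ) else 0))) := by
    intro n hn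
    have hn0 : (0 : ℝ) < n := by exact_mod_cast Nat.pos_of_ne_zero (ne_zero_of_mem_afeBox hn)
    have h1 := hC n
    have h2 := sqrt_gcd_prime_le hq n
    have e : ((n : ℝ)) ^ (-(51 / 50 : ℝ)) * ((n : ℝ)) ^ (1 / 100 : ℝ) = ((n : ℝ)) ^ (-(101 / 100 : ℝ)) := by
      rw [← Real.rpow_add hn0]; norm_num
    calc ((n : ℝ)) ^ (-(51 / 50 : ℝ)) * (((n.divisors.card : ℕ) : ℝ) * Real.sqrt ((Nat.gcd n q : ℕ) : ℝ))
        ≤ ((n : ℝ)) ^ (-(51 / 50 : ℝ)) * ((C * ((n : ℝ)) ^ (1 / 100 : ℝ)) *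
            (1 + (if q ∣ n then Real.sqrt (q : ℝ) else 0))) := by
          refine mul_le_mul_of_nonneg_left ?_ (Real.rpow_nonneg hn0.le _)
          exact mul_le_mul h1 h2 (Real.sqrt_nonneg _) (by positivity)
      _ = C * ((((n : ℝ)) ^ (-(51 / 50 : ℝ)) * ((n : ℝ)) ^ (1 / 100 : ℝ)) *
            (1 + (if q ∣ n then Real.sqrt (q : ℝ) else 0))) := by ring
      _ = _ := by rw [e]
  -- the generic part
  have hgen : ∑ n ∈ afeBox q, ((n : ℝ)) ^ (-(101 / 100 : ℝ)) ≤ Z :=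
    summable_rpow_101.sum_le_tsum _ (fun k _ ↦ Real.rpow_nonneg (Nat.cast_nonneg _) _)
  -- the multiples of `q`
  have hmul : ∑ n ∈ afeBox q, ((n : ℝ)) ^ (-(101 / 100 : ℝ)) * (if q ∣ n then Real.sqrt (q : ℝ) else 0) ≤ Z := by
    have hrw : ∑ n ∈ afeBox q, ((n : ℝ)) ^ (-(101 / 100 : ℝ)) * (if q ∣ n then Real.sqrt (q : ℝ) else 0) =
        (∑ n ∈ (afeBox q).filter (fun n ↦ q ∣ n), ((n : ℝ)) ^ (-(101 / 100 : ℝ))) * Real.sqrt (q : ℝ) := by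
      rw [Finset.sum_mul, Finset.sum_filter]
      refine Finset.sum_congr rfl fun n _ ↦ ?_
      split_ifs <;> simp
    rw [hrw]
    have hs := sum_filter_dvd_rpow_le hq.ne_zero 0 (q ^ 2)
    rw [zero_add] at hs
    have hsq : Real.sqrt (q : ℝ) * ((q : ℝ)) ^ (-(101 / 100 : ℝ)) ≤ 1 := by
      rw [Real.sqrt_eq_rpow, ← Real.rpow_add hq0]
      exact Real.rpow_le_one_of_one_le_of_nonpos hq1 (by norm_num)
    calc (∑ n ∈ (afeBox q).filter (fun n ↦ q ∣ n), ((n : ℝ)) ^ (-(101 / 100 : ℝ))) * Real.sqrt (q : ℝ)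
        ≤ (((q : ℝ)) ^ (-(101 / 100 : ℝ)) * Z) * Real.sqrt (q : ℝ) := by
          refine mul_le_mul_of_nonneg_right ?_ (Real.sqrt_nonneg _)
          unfold afeBox
          exact hs
      _ = (Real.sqrt (q : ℝ) * ((q : ℝ)) ^ (-(101 / 100 : ℝ))) * Z := by ring
      _ ≤ 1 * Z := mul_le_mul_of_nonneg_right hsq hZ0
      _ = Z := one_mul _
  calc ∑ n ∈ afeBox q, ((n : ℝ)) ^ (-(51 / 50 : ℝ)) * (((n.divisors.card : ℕ) : ℝ) * Real.sqrt ((Nat.gcd n q : ℕ) : ℝ))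
      ≤ ∑ n ∈ afeBox q, C * (((n : ℝ)) ^ (-(101 / 100 : ℝ)) * (1 + (if q ∣ n then Real.sqrt (q : ℝ) else 0))) :=
        Finset.sum_le_sum hpt
    _ = C * (∑ n ∈ afeBox q, ((n : ℝ)) ^ (-(101 / 100 : ℝ)) +
          ∑ n ∈ afeBox q, ((n : ℝ)) ^ (-(101 / 100 : ℝ)) * (if q ∣ n then Real.sqrt (q : ℝ) else 0)) := by
        rw [← Finset.mul_sum, ← Finset.sum_add_distrib]
        refine congrArg (C * ·) (Finset.sum_congr rfl fun n _ ↦ ?_)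
        ring
    _ ≤ C * (Z + Z) := mul_le_mul_of_nonneg_left (add_le_add hgen hmul) hC0
    _ = 2 * C * Z := by ring

end Summit.Parity.GeneralizedHardyLittlewood.Theorems.MomentsBeyondDiagonal.FarLayers

end
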